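import Summits.QuantumFields.YangMills.Theorems.BalabanUVNodesSpineRatesHolder
import Summits.QuantumFields.YangMills.Theorems.BalabanUVNodesN27ReadOutAtU3OfKernels
import Summits.QuantumFields.YangMills.Theorems.BalabanUVNodesN22AtU3OfKernels
import Summits.QuantumFields.YangMills.Theorems.BalabanUVNodesN18AtU3OfKernels

/-!
# BalabanUVNodes ∕ N27 = binder B5 AT THE RECORD — module (Kᴿ): K4's SIX β-RATES `RatesHolderAt D R β` (dag-n16-e 41ᴴ) AND (D4) `ReadOutAt D R.u3` ASSEMBLED AT THE RUN-LENGTH BUNDLES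
# OF A STAGE-13 RATE READING **PINNED TO node00-def-W1's KERNEL-KEYED U3 OBJECTS OF RECORD** — the K3⁷ v3 (02f6f498332fdbee) pin `U3PinnedKernels 𝔯 ℓ` read PER TUPLE
# (`hpin : (𝔯.lit F θ hP g₀ os).u3 = objectsOfRecord₁₃ F N θ.toStage13Params ℓ`, the three producer files' shape VERBATIM) — i.e. the BODY SHAPE of v3's `stub_rates13H` rates half
# `KeyedRatesHolderD4 β (rrOfRecord 𝔯 ksel)` AT ANY SELECTOR VALUE `k`, in tree vocabulary, FROM THE ROWS plan g81 l.26426 (i) names: N14 ∕ N15 ∕ N16-at-β rows of the reading at the tuple,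
# N22 = windowed history-NE9 + `PolLimitExists` of the merged term family of record (dag-n22-w3 p593053), N18 = N22 + `ω ≤ θ₅` + NE5 at ONE member (dag-n18-w1 p593165), (D4) = (5.10) of record +
# `Signs`∕`0 < κ`∕`betaPrime510 4 1 κ ≤ cr` (this seat's g0 p591653), N17 = the Stage-13 U3 → U2 edge `n17At_of_u3` ((D4) ∧ N18 ∧ N22 ⇒ NE4 on the datum; the all-k anchor road of dag-n17-w1∕w2 is the
# OTHER road and is not used here)
# (cell `pub-ymgap`, HUMAN RULING D-0062 Track A; director-ym №197 ∕ HUMAN RULING D-0149; width seat `pub-ymgap-dag-n27-w1` gen 2 on NODE n27 (B5 composite); K3⁷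
# `SpineGivenEndpointR13SepCoPH` = stmt-QuantumFields-20544, `--kind proof --supports 20544 --as helper`; COUNT-NEUTRAL; THEOREMS ONLY, 0 `def`, 0 `sorry`; `N`-generic, NO Theses import, does NOT
# import the skeleton (its `KeyedRatesHolderD4 ∕ rrOfRecord ∕ GuardedReading` are kit-local); the `∀ k` conclusion below IS the antecedent of the N19′ edge `h19` of (Q) ∕ (K) ∕ (Kᴾ))

WHAT IS KERNEL-CHECKED ([bookkeeping]).
* §1 ONE TUPLE, ONE RUN LENGTH, rows as hypotheses at the kernel bundle: `rateCarriers_u3_of_kernels_pin` (the bundle's U3 component IS `u3OfRecord₁₃ θ (objectsOfRecord₁₃ F N θ ℓ) k`) ·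
  ★ `readOutAt_rateCarriers_of_kernels_pin` ((D4) at the bundle from the four kernel inputs) · `n17At_rateCarriers_of_kernels_pin` (N17 at the bundle from the four kernel inputs + N18 + N22 at the
  kernel bundle) · ★★ `ratesHolderAt_rateCarriers_of_kernels_pin` (`RatesHolderAt (datumOfRecord₁₃CoPH F N θ hP) (rateCarriersOfRecord₁₃CoPH 𝔯 F θ hP g₀ os k) β` from the N14 ∕ N15 ∕ N16-at-β rows
  of the reading + the four kernel inputs + N18 ∕ N22 at the kernel bundle).
* §2 PRODUCER CURRENCY: ★★ `ratesHolderAt_rateCarriers_of_kernels_pin_of_windowed_member` (N22 ⟸ windowed bounds + `PolLimitExists`; N18 ⟸ N22 + `ω ≤ θ₅` + one NE5 member) ·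
  `readOutAt_and_ratesHolderAt_rateCarriers_of_kernels_pin_of_windowed_member` (the pair `RatesHolderAt … β ∧ ReadOutAt …` = v3's `KeyedRatesHolderD4` body at the selected run length).
* §3 THE θ-KEYED FAMILY FORMS under any guard `G` and letter reading `ℓ F θ`: `forall_ratesHolderAt_rateCarriers_of_kernels_pin_of_windowed_member` (every guarded admissible tuple, every `g₀ os k`) —
  the N19′ edge's antecedent `∀ k, RatesHolderAt …` in (Q) §1 ∕ (K) §2 ∕ (Kᴾ) §2, and v3's stub-1 rates half at any selector.

HONEST FRAMING.  Bookkeeping BY NAME; every row is a DISPLAYED HYPOTHESIS inhabited for no family today (K0⁷ `Record13SepCoPHInhabited` OPEN): NE1′ on `𝔯.ne1`, NE2 on the reading's N15 layer,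
NE3 at exponent β on its N16 layer, the windowed finite-volume joint history-Lipschitz bounds (= NE9 at finite volume, NOT PRINTED for d = 4), the existence of the (1.21) limits (def-B's
`PolLimitExists`, [Balaban1987RG1] p. 264 — NOT proved), NE5 at one member, (5.10) for the limiting kernels (p. 293 — print's claim, NOT proved); NE4 is DERIVED on the datum by the kernel-checked
U3 → U2 edge, not proved as an estimate of Bałaban's; β a LETTER; nothing of Bałaban's asserted or instantiated; no `Provisos₁₃CoPH` inhabitant claimed; no stub of K3⁷ v3 closed or claimed (this is
NOT `stub_rates13H`: no `∃ 𝔯`, no guard inhabitant, rows hypothesised); N14–N18 ∕ N22 ∕ N27 NOT discharged; every landed decl UNTOUCHED (additive file); counts UNMOVED (typed 28∕28 · discharged 5∕27, A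
5∕28); one finite four-torus programme at fixed `ε` — R4 closes the conditional rung `BalabanLadder.UV` only: NOT ℝ⁴, NOT infinite volume, NOT OS, NOT a mass gap, NOT Clay.  No decl below carries a cite tag.
-/

set_option autoImplicit false

namespace Summit.QuantumFields.YangMills.Theorems.BalabanUVNodesN27SpineRecord

open Filter
open scoped Matrix.Norms.L2Operator
open Literature.MathematicalPhysics.QuantumFieldTheory.Balaban1983to89
open Literature.MathematicalPhysics.QuantumFieldTheory.Balaban1983to89.T4Continuum
open Literature.MathematicalPhysics.QuantumFieldTheory.Balaban1983to89.T4OutputRate (Window NE5)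
open Literature.MathematicalPhysics.QuantumFieldTheory.Balaban1983to89.B12Sec2to5 (betaPrime510 l1)
open Literature.MathematicalPhysics.QuantumFieldTheory.Balaban1983to89.Node00 (polWindow PolLimitExists mergedTermFamilyMatT TβOfRecord₁₃ chiβOfRecord₁₃)
open Literature.MathematicalPhysics.QuantumFieldTheory.Balaban1983to89.Node00.U3OfKernels (histPrefix objectsOfRecord₁₃ KernelDecayOfRecord₁₃)
open YMDAG.UVSplit
open Node00 (Stage13HParams datumOfRecord₁₃CoPH U3Letters₁₁)
open Summit.QuantumFields.YangMills.BalabanUVNodes.N16HolderDefs (N16HolderAt)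
open Summit.QuantumFields.YangMills.BalabanUVNodes.SpineRatesHolder (RatesHolderAt)
open Summit.QuantumFields.YangMills.BalabanUVNodes.N27ReadOutAtU3OfKernels (readOutAt_objectsOfRecord₁₃_coPH)
open YMDAG.N22.AtKernels (n22At_u3OfRecord₁₃_objectsOfRecord₁₃_of_windowed)
open YMDAG.N18.AtU3OfKernels (n18At_u3OfRecord₁₃_objectsOfRecord₁₃_of_n22At_of_member)

variable {N : ℕ} [NeZero N]

/-! ## §1 One tuple, one run length: the rows as hypotheses at the kernel bundle of record -/

section OneTuple

variable (𝔯 : RateReading₁₃CoPH N) {F : T4Family} (θ : Stage13HParams F N) (hP : θ.Provisos₁₃CoPH F N) (g₀ : ℕ → ℝ) (os : List (ULoop F)) (ℓ : U3Letters₁₁)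
  (hpin : (𝔯.lit F θ hP g₀ os).u3 = objectsOfRecord₁₃ F N θ.toStage13Params ℓ)
include hpin

/-- Under the pin the run-length-`k` bundle's U3 component IS the kernel bundle of record `u3OfRecord₁₃ θ (objectsOfRecord₁₃ F N θ ℓ) k` (rewrite along `hpin`). [bookkeeping] -/
theorem rateCarriers_u3_of_kernels_pin (k : ℕ) :
    (rateCarriersOfRecord₁₃CoPH 𝔯 F θ hP g₀ os k).u3 = u3OfRecord₁₃ θ.toStage13Params (objectsOfRecord₁₃ F N θ.toStage13Params ℓ) k := by
  show u3OfRecord₁₃ θ.toStage13Params (𝔯.lit F θ hP g₀ os).u3 k = _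
  rw [hpin]

/-- ★ **(D4) AT THE BUNDLE OF A KERNEL-PINNED READING FROM PRINT's (5.10)**: `ReadOutAt (datumOfRecord₁₃CoPH F N θ hP) (rateCarriersOfRecord₁₃CoPH 𝔯 F θ hP g₀ os k).u3` from `ℓ.Signs`,
`0 < ℓ.κ`, `betaPrime510 4 1 ℓ.κ ≤ ℓ.cr` and the ONE clause `KernelDecayOfRecord₁₃ F N θ.toStage13Params 0 1 ℓ.κ` (g0 `readOutAt_objectsOfRecord₁₃_coPH`).  A reduction; (5.10) NOT proved.
[bookkeeping] -/
theorem readOutAt_rateCarriers_of_kernels_pin (hs : ℓ.Signs) (hκ : 0 < ℓ.κ) (hcr : betaPrime510 4 1 ℓ.κ ≤ ℓ.cr) (hdec : KernelDecayOfRecord₁₃ F N θ.toStage13Params 0 1 ℓ.κ) (k : ℕ) :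
    ReadOutAt (datumOfRecord₁₃CoPH F N θ hP) (rateCarriersOfRecord₁₃CoPH 𝔯 F θ hP g₀ os k).u3 := by
  rw [rateCarriers_u3_of_kernels_pin 𝔯 θ hP g₀ os ℓ hpin k]
  exact readOutAt_objectsOfRecord₁₃_coPH θ hP ℓ hs hκ hcr k hdec

/-- **N17 AT THE BUNDLE OF A KERNEL-PINNED READING** — the Stage-13 U3 → U2 edge `n17At_of_u3` ((D4) ∧ N18 ∧ N22 ⇒ NE4 on the datum) with (D4) from the four kernel inputs; N18 ∕ N22 at the
kernel bundle are hypotheses.  NE4 ∕ NE5 ∕ NE9 NOT proved. [bookkeeping] -/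
theorem n17At_rateCarriers_of_kernels_pin (hs : ℓ.Signs) (hκ : 0 < ℓ.κ) (hcr : betaPrime510 4 1 ℓ.κ ≤ ℓ.cr) (hdec : KernelDecayOfRecord₁₃ F N θ.toStage13Params 0 1 ℓ.κ) (k : ℕ)
    (h18 : N18At (u3OfRecord₁₃ θ.toStage13Params (objectsOfRecord₁₃ F N θ.toStage13Params ℓ) k))
    (h22 : N22At (u3OfRecord₁₃ θ.toStage13Params (objectsOfRecord₁₃ F N θ.toStage13Params ℓ) k)) :
    N17At (datumOfRecord₁₃CoPH F N θ hP) (rateCarriersOfRecord₁₃CoPH 𝔯 F θ hP g₀ os k).u3 := by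
  rw [rateCarriers_u3_of_kernels_pin 𝔯 θ hP g₀ os ℓ hpin k]
  exact n17At_of_u3 _ (readOutAt_objectsOfRecord₁₃_coPH θ hP ℓ hs hκ hcr k hdec) h18 h22

/-- ★★ **K4's SIX β-RATES AT THE BUNDLE OF A KERNEL-PINNED READING FROM THE ROWS**: `RatesHolderAt (datumOfRecord₁₃CoPH F N θ hP) (rateCarriersOfRecord₁₃CoPH 𝔯 F θ hP g₀ os k) β` from the
reading's N14 ∕ N15 ∕ N16-at-β rows at the tuple and run length, the four kernel inputs `ℓ.Signs`, `0 < κ`, `betaPrime510 4 1 κ ≤ cr`, `KernelDecayOfRecord₁₃ F N θ 0 1 κ`, and N18 ∕ N22 at the kernel bundle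
of record (N17 by the U3 → U2 edge).  Every row a hypothesis; nothing of Bałaban's proved. [bookkeeping] -/
theorem ratesHolderAt_rateCarriers_of_kernels_pin (β : ℝ) (k : ℕ)
    (h14 : N14At (𝔯.ne1 F θ hP g₀ os)) (h15 : N15At (ne2OfRecord₁₁ ((𝔯.lit F θ hP g₀ os).ne2 k))) (h16 : N16HolderAt (ne3OfRecord₁₁ F ((𝔯.lit F θ hP g₀ os).ne3 k)) β)
    (hs : ℓ.Signs) (hκ : 0 < ℓ.κ) (hcr : betaPrime510 4 1 ℓ.κ ≤ ℓ.cr) (hdec : KernelDecayOfRecord₁₃ F N θ.toStage13Params 0 1 ℓ.κ)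
    (h18 : N18At (u3OfRecord₁₃ θ.toStage13Params (objectsOfRecord₁₃ F N θ.toStage13Params ℓ) k))
    (h22 : N22At (u3OfRecord₁₃ θ.toStage13Params (objectsOfRecord₁₃ F N θ.toStage13Params ℓ) k)) :
    RatesHolderAt (datumOfRecord₁₃CoPH F N θ hP) (rateCarriersOfRecord₁₃CoPH 𝔯 F θ hP g₀ os k) β := by
  refine ⟨h14, h15, h16, n17At_rateCarriers_of_kernels_pin 𝔯 θ hP g₀ os ℓ hpin hs hκ hcr hdec k h18 h22, ?_, ?_⟩
  · rw [rateCarriers_u3_of_kernels_pin 𝔯 θ hP g₀ os ℓ hpin k]; exact h18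
  · rw [rateCarriers_u3_of_kernels_pin 𝔯 θ hP g₀ os ℓ hpin k]; exact h22

/-! ## §2 Producer currency: N22 ⟸ windowed bounds + `PolLimitExists` (dag-n22-w3), N18 ⟸ N22 + `ω ≤ θ₅` + one NE5 member (dag-n18-w1) -/

/-- ★★ **K4's SIX β-RATES AT THE BUNDLE OF A KERNEL-PINNED READING, EVERY U3 ROW IN ITS PRODUCER's KERNEL CURRENCY**: N22 from `PolLimitExists` of the merged term family of record at every
history of the window and the windowed joint history-Lipschitz bounds with the moduli of record (`n22At_u3OfRecord₁₃_objectsOfRecord₁₃_of_windowed`); N18 from that N22 + `ℓ.ω ≤ ℓ.θ₅` + NE5 at ONE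
member `b₀ ∈ ]0, θ.γ]` with constant `ℓ.C₅ − ℓ.C₉·θ.γ` (`n18At_u3OfRecord₁₃_objectsOfRecord₁₃_of_n22At_of_member`); (D4) ∕ N17 from the four kernel inputs; N14 ∕ N15 ∕ N16-at-β rows of the reading.
LOCATED (hypothesis form); nothing discharged. [bookkeeping] -/
theorem ratesHolderAt_rateCarriers_of_kernels_pin_of_windowed_member (β : ℝ) (k : ℕ)
    (h14 : N14At (𝔯.ne1 F θ hP g₀ os)) (h15 : N15At (ne2OfRecord₁₁ ((𝔯.lit F θ hP g₀ os).ne2 k))) (h16 : N16HolderAt (ne3OfRecord₁₁ F ((𝔯.lit F θ hP g₀ os).ne3 k)) β)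
    (hs : ℓ.Signs) (hκ : 0 < ℓ.κ) (hcr : betaPrime510 4 1 ℓ.κ ≤ ℓ.cr) (hωθ : ℓ.ω ≤ ℓ.θ₅) (hdec : KernelDecayOfRecord₁₃ F N θ.toStage13Params 0 1 ℓ.κ)
    (hlim : letI := θ.instVβ₁; letI := θ.instVβ₂; letI := θ.instιβ
      ∀ g ∈ Window θ.γ, ∀ j : ℕ,
        PolLimitExists F (j + 1) (fun K => mergedTermFamilyMatT F N (TβOfRecord₁₃ F N) (chiβOfRecord₁₃ F N θ.toStage13Params) θ.εbg j (histPrefix g j) K) θ.ρ8 θ.bV)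
    (hK : letI := θ.instVβ₁; letI := θ.instVβ₂; letI := θ.instιβ
      ∀ g ∈ Window θ.γ, ∀ g' ∈ Window θ.γ, ∀ (j : ℕ) (μ ν : Fin 4) (z : Fin 4 → ℤ), ∀ᶠ K in atTop,
        |polWindow F K (j + 1) (mergedTermFamilyMatT F N (TβOfRecord₁₃ F N) (chiβOfRecord₁₃ F N θ.toStage13Params) θ.εbg j (histPrefix g j) K) θ.ρ8 θ.bV μ ν z -
            polWindow F K (j + 1) (mergedTermFamilyMatT F N (TβOfRecord₁₃ F N) (chiβOfRecord₁₃ F N θ.toStage13Params) θ.εbg j (histPrefix g' j) K) θ.ρ8 θ.bV μ ν z| ≤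
          Real.exp (-(ℓ.κ * l1 z)) * ∑ i ∈ Finset.range (j + 1), ℓ.moduli (j + 1) i * |g i - g' i|)
    {b₀ : ℝ} (hb₀ : 0 < b₀) (hb₀γ : b₀ ≤ θ.γ)
    (h5 : NE5 ((objectsOfRecord₁₃ F N θ.toStage13Params ℓ).EA k) ((objectsOfRecord₁₃ F N θ.toStage13Params ℓ).EB k b₀) (Window θ.γ) ℓ.κ ℓ.θ₅ (ℓ.C₅ - ℓ.C₉ * θ.γ)) :
    RatesHolderAt (datumOfRecord₁₃CoPH F N θ hP) (rateCarriersOfRecord₁₃CoPH 𝔯 F θ hP g₀ os k) β :=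
  have h22 : N22At (u3OfRecord₁₃ θ.toStage13Params (objectsOfRecord₁₃ F N θ.toStage13Params ℓ) k) :=
    n22At_u3OfRecord₁₃_objectsOfRecord₁₃_of_windowed F N θ.toStage13Params ℓ hs k hlim hK
  ratesHolderAt_rateCarriers_of_kernels_pin 𝔯 θ hP g₀ os ℓ hpin β k h14 h15 h16 hs hκ hcr hdec
    (n18At_u3OfRecord₁₃_objectsOfRecord₁₃_of_n22At_of_member F N θ.toStage13Params ℓ hs hωθ k k h22 hb₀ hb₀γ h5) h22

/-- **THE PAIR `RatesHolderAt … β ∧ ReadOutAt …` AT THE SELECTED RUN LENGTH** — the body shape of K3⁷ v3's `KeyedRatesHolderD4 β (rrOfRecord 𝔯 ksel)` at the tuple (rates half ∧ (D4) half), in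
producer currency.  NOT `stub_rates13H` (no `∃ 𝔯`, no guard inhabitant; rows hypothesised). [bookkeeping] -/
theorem readOutAt_and_ratesHolderAt_rateCarriers_of_kernels_pin_of_windowed_member (β : ℝ) (k : ℕ)
    (h14 : N14At (𝔯.ne1 F θ hP g₀ os)) (h15 : N15At (ne2OfRecord₁₁ ((𝔯.lit F θ hP g₀ os).ne2 k))) (h16 : N16HolderAt (ne3OfRecord₁₁ F ((𝔯.lit F θ hP g₀ os).ne3 k)) β)
    (hs : ℓ.Signs) (hκ : 0 < ℓ.κ) (hcr : betaPrime510 4 1 ℓ.κ ≤ ℓ.cr) (hωθ : ℓ.ω ≤ ℓ.θ₅) (hdec : KernelDecayOfRecord₁₃ F N θ.toStage13Params 0 1 ℓ.κ)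
    (hlim : letI := θ.instVβ₁; letI := θ.instVβ₂; letI := θ.instιβ
      ∀ g ∈ Window θ.γ, ∀ j : ℕ,
        PolLimitExists F (j + 1) (fun K => mergedTermFamilyMatT F N (TβOfRecord₁₃ F N) (chiβOfRecord₁₃ F N θ.toStage13Params) θ.εbg j (histPrefix g j) K) θ.ρ8 θ.bV)
    (hK : letI := θ.instVβ₁; letI := θ.instVβ₂; letI := θ.instιβ
      ∀ g ∈ Window θ.γ, ∀ g' ∈ Window θ.γ, ∀ (j : ℕ) (μ ν : Fin 4) (z : Fin 4 → ℤ), ∀ᶠ K in atTop,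
        |polWindow F K (j + 1) (mergedTermFamilyMatT F N (TβOfRecord₁₃ F N) (chiβOfRecord₁₃ F N θ.toStage13Params) θ.εbg j (histPrefix g j) K) θ.ρ8 θ.bV μ ν z -
            polWindow F K (j + 1) (mergedTermFamilyMatT F N (TβOfRecord₁₃ F N) (chiβOfRecord₁₃ F N θ.toStage13Params) θ.εbg j (histPrefix g' j) K) θ.ρ8 θ.bV μ ν z| ≤
          Real.exp (-(ℓ.κ * l1 z)) * ∑ i ∈ Finset.range (j + 1), ℓ.moduli (j + 1) i * |g i - g' i|)
    {b₀ : ℝ} (hb₀ : 0 < b₀) (hb₀γ : b₀ ≤ θ.γ)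
    (h5 : NE5 ((objectsOfRecord₁₃ F N θ.toStage13Params ℓ).EA k) ((objectsOfRecord₁₃ F N θ.toStage13Params ℓ).EB k b₀) (Window θ.γ) ℓ.κ ℓ.θ₅ (ℓ.C₅ - ℓ.C₉ * θ.γ)) :
    RatesHolderAt (datumOfRecord₁₃CoPH F N θ hP) (rateCarriersOfRecord₁₃CoPH 𝔯 F θ hP g₀ os k) β ∧
      ReadOutAt (datumOfRecord₁₃CoPH F N θ hP) (rateCarriersOfRecord₁₃CoPH 𝔯 F θ hP g₀ os k).u3 :=
  ⟨ratesHolderAt_rateCarriers_of_kernels_pin_of_windowed_member 𝔯 θ hP g₀ os ℓ hpin β k h14 h15 h16 hs hκ hcr hωθ hdec hlim hK hb₀ hb₀γ h5,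
    readOutAt_rateCarriers_of_kernels_pin 𝔯 θ hP g₀ os ℓ hpin hs hκ hcr hdec k⟩

end OneTuple

/-! ## §3 The θ-keyed family form (any guard `G`, letter reading `ℓ F θ`) -/

/-- **THE θ-KEYED FAMILY FORM IN PRODUCER CURRENCY**: for a reading pinned at every tuple (`hpin`, K3⁷ v3's `U3PinnedKernels 𝔯 ℓ` shape) and rows keyed on the guarded admissible tuples,
`∀ F θ hP, G θ → θ.Admissible F N → ∀ g₀ os k, RatesHolderAt (datumOfRecord₁₃CoPH F N θ hP) (rateCarriersOfRecord₁₃CoPH 𝔯 F θ hP g₀ os k) β` — the N19′ edge's antecedent in (Q) §1 ∕ (K) §2 ∕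
(Kᴾ) §2 and the rates half of v3's stub 1 at any selector.  Every row a hypothesis (0∕1 today). [bookkeeping] -/
theorem forall_ratesHolderAt_rateCarriers_of_kernels_pin_of_windowed_member (𝔯 : RateReading₁₃CoPH N) (G : ∀ {F : T4Family}, Stage13HParams F N → Prop)
    (ℓ : (F : T4Family) → Stage13HParams F N → U3Letters₁₁) (β : ℝ)
    (hpin : ∀ (F : T4Family) (θ : Stage13HParams F N) (hP : θ.Provisos₁₃CoPH F N) (g₀ : ℕ → ℝ) (os : List (ULoop F)),
      (𝔯.lit F θ hP g₀ os).u3 = objectsOfRecord₁₃ F N θ.toStage13Params (ℓ F θ))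
    (h14 : ∀ (F : T4Family) (θ : Stage13HParams F N) (hP : θ.Provisos₁₃CoPH F N), G θ → θ.Admissible F N → ∀ (g₀ : ℕ → ℝ) (os : List (ULoop F)), N14At (𝔯.ne1 F θ hP g₀ os))
    (h15 : ∀ (F : T4Family) (θ : Stage13HParams F N) (hP : θ.Provisos₁₃CoPH F N), G θ → θ.Admissible F N → ∀ (g₀ : ℕ → ℝ) (os : List (ULoop F)) (k : ℕ),
      N15At (ne2OfRecord₁₁ ((𝔯.lit F θ hP g₀ os).ne2 k)))
    (h16 : ∀ (F : T4Family) (θ : Stage13HParams F N) (hP : θ.Provisos₁₃CoPH F N), G θ → θ.Admissible F N → ∀ (g₀ : ℕ → ℝ) (os : List (ULoop F)) (k : ℕ),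
      N16HolderAt (ne3OfRecord₁₁ F ((𝔯.lit F θ hP g₀ os).ne3 k)) β)
    (hs : ∀ (F : T4Family) (θ : Stage13HParams F N), θ.Provisos₁₃CoPH F N → G θ → θ.Admissible F N → (ℓ F θ).Signs)
    (hκ : ∀ (F : T4Family) (θ : Stage13HParams F N), θ.Provisos₁₃CoPH F N → G θ → θ.Admissible F N → 0 < (ℓ F θ).κ)
    (hcr : ∀ (F : T4Family) (θ : Stage13HParams F N), θ.Provisos₁₃CoPH F N → G θ → θ.Admissible F N → betaPrime510 4 1 (ℓ F θ).κ ≤ (ℓ F θ).cr)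
    (hωθ : ∀ (F : T4Family) (θ : Stage13HParams F N), θ.Provisos₁₃CoPH F N → G θ → θ.Admissible F N → (ℓ F θ).ω ≤ (ℓ F θ).θ₅)
    (hdec : ∀ (F : T4Family) (θ : Stage13HParams F N), θ.Provisos₁₃CoPH F N → G θ → θ.Admissible F N → KernelDecayOfRecord₁₃ F N θ.toStage13Params 0 1 (ℓ F θ).κ)
    (hlim : ∀ (F : T4Family) (θ : Stage13HParams F N), θ.Provisos₁₃CoPH F N → G θ → θ.Admissible F N →
      letI := θ.instVβ₁; letI := θ.instVβ₂; letI := θ.instιβ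
      ∀ g ∈ Window θ.γ, ∀ j : ℕ,
        PolLimitExists F (j + 1) (fun K => mergedTermFamilyMatT F N (TβOfRecord₁₃ F N) (chiβOfRecord₁₃ F N θ.toStage13Params) θ.εbg j (histPrefix g j) K) θ.ρ8 θ.bV)
    (hK : ∀ (F : T4Family) (θ : Stage13HParams F N), θ.Provisos₁₃CoPH F N → G θ → θ.Admissible F N →
      letI := θ.instVβ₁; letI := θ.instVβ₂; letI := θ.instιβ
      ∀ g ∈ Window θ.γ, ∀ g' ∈ Window θ.γ, ∀ (j : ℕ) (μ ν : Fin 4) (z : Fin 4 → ℤ), ∀ᶠ K in atTop,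
        |polWindow F K (j + 1) (mergedTermFamilyMatT F N (TβOfRecord₁₃ F N) (chiβOfRecord₁₃ F N θ.toStage13Params) θ.εbg j (histPrefix g j) K) θ.ρ8 θ.bV μ ν z -
            polWindow F K (j + 1) (mergedTermFamilyMatT F N (TβOfRecord₁₃ F N) (chiβOfRecord₁₃ F N θ.toStage13Params) θ.εbg j (histPrefix g' j) K) θ.ρ8 θ.bV μ ν z| ≤
          Real.exp (-((ℓ F θ).κ * l1 z)) * ∑ i ∈ Finset.range (j + 1), (ℓ F θ).moduli (j + 1) i * |g i - g' i|)
    (h5 : ∀ (F : T4Family) (θ : Stage13HParams F N), θ.Provisos₁₃CoPH F N → G θ → θ.Admissible F N → ∀ k : ℕ, ∃ b₀ : ℝ, 0 < b₀ ∧ b₀ ≤ θ.γ ∧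
      NE5 ((objectsOfRecord₁₃ F N θ.toStage13Params (ℓ F θ)).EA k) ((objectsOfRecord₁₃ F N θ.toStage13Params (ℓ F θ)).EB k b₀) (Window θ.γ) (ℓ F θ).κ (ℓ F θ).θ₅
        ((ℓ F θ).C₅ - (ℓ F θ).C₉ * θ.γ)) :
    ∀ (F : T4Family) (θ : Stage13HParams F N) (hP : θ.Provisos₁₃CoPH F N), G θ → θ.Admissible F N → ∀ (g₀ : ℕ → ℝ) (os : List (ULoop F)) (k : ℕ),
      RatesHolderAt (datumOfRecord₁₃CoPH F N θ hP) (rateCarriersOfRecord₁₃CoPH 𝔯 F θ hP g₀ os k) β := by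
  intro F θ hP hG hθ g₀ os k
  obtain ⟨b₀, hb₀, hb₀γ, h5'⟩ := h5 F θ hP hG hθ k
  exact ratesHolderAt_rateCarriers_of_kernels_pin_of_windowed_member 𝔯 θ hP g₀ os (ℓ F θ) (hpin F θ hP g₀ os) β k (h14 F θ hP hG hθ g₀ os) (h15 F θ hP hG hθ g₀ os k)
    (h16 F θ hP hG hθ g₀ os k) (hs F θ hP hG hθ) (hκ F θ hP hG hθ) (hcr F θ hP hG hθ) (hωθ F θ hP hG hθ) (hdec F θ hP hG hθ) (hlim F θ hP hG hθ) (hK F θ hP hG hθ) hb₀ hb₀γ h5'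

end Summit.QuantumFields.YangMills.Theorems.BalabanUVNodesN27SpineRecord
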